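import Summits.HodgeConjecture.HodgeConjecture.Cruxes.BlochSeedDiscOne.SeedCheckerSplitBlock

/-!
# ROW-α1 typed against v41 `SeedCheckerSplitBlock.lean` (33549372ef92ed79): the three doors' RULE-D rows, the orientation flag
(idea-crit-hsem-3 g23, memo-211; director-hodge R19.839 «g0 types, you compute against the type», R19.841 (C) ∕ (C2))

Token: line stmt-HodgeConjecture-18881 Cruxes/BlochSeedDiscOne/Lines/birth.lean 814a6a70c14e831a stub_rung_pad4_seedAt.

TYPING ∕ BOOKKEEPING ONLY.  Evidence-grade file (not a rung; not on any skeleton's path); sorry-free; no `axiom` ∕ `instance` ∕ `unsafe` ∕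
`native_decide`; nothing here is proved toward HC ∕ HC_CM ∕ HC_AV ∕ №4 ∕ 26512 ∕ 18881 ∕ 30548 ∕ H2.  Every «row» below is a `Prop`-valued
definition; the only theorems are unfoldings (`Iff.rfl`), monotonicity, and the letter-level consequence of `RuleDPlate.mu_eq_zero_of_a4sharp_ruleD`.

* `RowSheaf R C I`  — «every split-block CORE passing the SHEAF door (cokernel orientation `0 → 𝓟 → 𝓝 → 𝓔 → 0`) has a shell design whose
  letter shadow satisfies `R`»; v41's `Rung2bSheaf C I σ π` IS `RowSheaf (ShadowRows σ π) C I` (`rung2bSheaf_iff`).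
  **ROW-α1 (memo-211 THEOREM α1, PEN): `RowSheaf LeggedFloor.RuleD C I`** — and in fact the sharper `RowSheaf RowAlpha1.RuleDSharp C I`
  (`RowAlpha1RuleDSharp.lean`) — holds for every `C`, `I ∋ 4`… as a consequence of Buchweitz–Flenner + naturality of the Atiyah class +
  Künneth; it is NOT kernel-provable on the tree's `IsISemiregular` interface (no Atiyah class there), so it is recorded as the DEFINITION
  `RowAlpha1Sheaf` with this docstring, not as a theorem.
* `RowSheafK R C I` — KERNEL orientation (`SplitBlockCoreK`, `0 → 𝓔 → 𝓝 → 𝓟 → 0`): the derived row is `R` of the SWAPPED shadow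
  (`swapD`: null steps reversed, memo-211 §6).  v41's `Rung2bSheafK` applies `ShadowRows` to the UNSWAPPED shadow (`rung2bSheafK_iff`) —
  for the RULE-D conjunct that is NOT what the derivation gives (TYPING FLAG (C2-K) of memo-211 §9).
* `RowLci R C` — lci door (`SplitBlockDatum.Passes`, line #2's 2b of record `Rung2b` = `RowLci (ShadowRows σ π)`): for `R = RuleD` NOT
  derived (memo-211 §7: a Bloch-semiregular `Z(s)` need not drag `𝓔` along `T_W`); status C; the repair of record is a named staticity law.
* `rowSheaf_mu_eq_zero_of_legFree` — under ROW-α1, a LEG-FREE (`A4sharp`) shadow of a passing sheaf core has `μ = 0`: with the class row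
  `μ ≠ 0` the leg-free split-block SHEAF ansatz is empty at every height (memo-151 THEOREM (d), now with every arrow derived) — the same
  fact as s4-search-1 g39's `LegBRegion.leg_free_ansatz_vacuous` (evidence #45), on which R19.853 (O5) withdrew `EntrySharp` from the scope;
  the live room is LEGGED, and there the derived row `RuleDSharp` (`RowAlpha1RuleDSharp.lean`) is strictly sharper than `RuleD`.
-/

set_option linter.dupNamespace false
set_option autoImplicit false

open CategoryTheory
open Literature.AlgebraicGeometry Literature.AlgebraicGeometry.Motives Literature.AlgebraicGeometry.HodgeTheory

namespace Summit.HodgeConjecture.HodgeConjecture.Cruxes.BlochSeedDiscOne.SeedChecker.SplitBlock.RowAlpha1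

open Summit.HodgeConjecture.HodgeConjecture.Cruxes.BlochSeedDiscOne

variable {C : ChernCharacterBetti}

/-- exchange the two sides of a letter design (`N ↔ P`); same as `RowAlpha1.swap` of `RowAlpha1RuleDSharp.lean`. -/
def swapD (D' : DepthBoundA4.Design) : DepthBoundA4.Design := ⟨D'.P, D'.N⟩

theorem swapD_swapD (D' : DepthBoundA4.Design) : swapD (swapD D') = D' := rfl

/-- **a ROW `R` over the SHEAF door, COKERNEL orientation**: every core passing the sheaf-seed checker (window `I`) on every CM anchor has a
shell design whose letter shadow satisfies `R`. -/
def RowSheaf (R : DepthBoundA4.Design → Prop) (C : ChernCharacterBetti) (I : Finset ℕ) : Prop :=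
  ∀ (E₀ : AbelianVariety ℂ) (ψ₀ : E₀ ⟶ E₀), E₀.dim = 1 → ψ₀ ≫ ψ₀ = -(1 • 𝟙 E₀) →
    ∀ δ : SplitBlockCore C E₀ ψ₀, δ.PassesSheaf I → R δ.Dsh.shadow

/-- **a ROW `R` over the SHEAF door, KERNEL orientation**: `R` is read on the SWAPPED shadow (the block map goes `L_N → L_P`; memo-211 §6). -/
def RowSheafK (R : DepthBoundA4.Design → Prop) (C : ChernCharacterBetti) (I : Finset ℕ) : Prop :=
  ∀ (E₀ : AbelianVariety ℂ) (ψ₀ : E₀ ⟶ E₀), E₀.dim = 1 → ψ₀ ≫ ψ₀ = -(1 • 𝟙 E₀) →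
    ∀ δ : SplitBlockCoreK C E₀ ψ₀, δ.PassesSheaf I → R (swapD δ.Dsh.shadow)

/-- **a ROW `R` over the lci door** (`SplitBlockDatum.Passes`; line #2's RUNG 2b reads `ShadowRows` here). -/
def RowLci (R : DepthBoundA4.Design → Prop) (C : ChernCharacterBetti) : Prop :=
  ∀ (E₀ : AbelianVariety ℂ) (ψ₀ : E₀ ⟶ E₀), E₀.dim = 1 → ψ₀ ≫ ψ₀ = -(1 • 𝟙 E₀) →
    ∀ δ : SplitBlockDatum C E₀ ψ₀, δ.Passes → R δ.Dsh.shadow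

theorem rowSheaf_mono {R R' : DepthBoundA4.Design → Prop} (hRR' : ∀ D', R D' → R' D') {I : Finset ℕ}
    (h : RowSheaf R C I) : RowSheaf R' C I :=
  fun E₀ ψ₀ hE hψ δ hδ => hRR' _ (h E₀ ψ₀ hE hψ δ hδ)

theorem rowSheafK_mono {R R' : DepthBoundA4.Design → Prop} (hRR' : ∀ D', R D' → R' D') {I : Finset ℕ}
    (h : RowSheafK R C I) : RowSheafK R' C I :=
  fun E₀ ψ₀ hE hψ δ hδ => hRR' _ (h E₀ ψ₀ hE hψ δ hδ)

theorem rowLci_mono {R R' : DepthBoundA4.Design → Prop} (hRR' : ∀ D', R D' → R' D')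
    (h : RowLci R C) : RowLci R' C :=
  fun E₀ ψ₀ hE hψ δ hδ => hRR' _ (h E₀ ψ₀ hE hψ δ hδ)

theorem rowSheaf_and {R R' : DepthBoundA4.Design → Prop} {I : Finset ℕ} (h : RowSheaf R C I) (h' : RowSheaf R' C I) :
    RowSheaf (fun D' => R D' ∧ R' D') C I :=
  fun E₀ ψ₀ hE hψ δ hδ => ⟨h E₀ ψ₀ hE hψ δ hδ, h' E₀ ψ₀ hE hψ δ hδ⟩

/-! ## v41's rungs 2b are rows of `ShadowRows σ π` -/

theorem rung2bSheaf_iff (I : Finset ℕ) (σ : DepthBoundA4.Design → ℤ) (π : ℤ) :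
    Rung2bSheaf C I σ π ↔ RowSheaf (ShadowRows σ π) C I := Iff.rfl

theorem rung2b_iff (σ : DepthBoundA4.Design → ℤ) (π : ℤ) : Rung2b C σ π ↔ RowLci (ShadowRows σ π) C := Iff.rfl

/-- v41's KERNEL-orientation rung applies `ShadowRows` to the UNSWAPPED shadow … -/
theorem rung2bSheafK_iff (I : Finset ℕ) (σ : DepthBoundA4.Design → ℤ) (π : ℤ) :
    Rung2bSheafK C I σ π ↔
      ∀ (E₀ : AbelianVariety ℂ) (ψ₀ : E₀ ⟶ E₀), E₀.dim = 1 → ψ₀ ≫ ψ₀ = -(1 • 𝟙 E₀) →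
        ∀ δ : SplitBlockCoreK C E₀ ψ₀, δ.PassesSheaf I → ShadowRows σ π δ.Dsh.shadow := Iff.rfl

/-- … i.e. it is the row of `ShadowRows σ π ∘ swapD` in the sense of `RowSheafK` (which swaps once more). -/
theorem rung2bSheafK_iff_rowSheafK (I : Finset ℕ) (σ : DepthBoundA4.Design → ℤ) (π : ℤ) :
    Rung2bSheafK C I σ π ↔ RowSheafK (fun D' => ShadowRows σ π (swapD D')) C I := Iff.rfl

/-- the RULE-D conjunct of v41's sheaf rung. -/
theorem rowSheaf_ruleD_of_rung2bSheaf {I : Finset ℕ} {σ : DepthBoundA4.Design → ℤ} {π : ℤ} (h : Rung2bSheaf C I σ π) :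
    RowSheaf LeggedFloor.RuleD C I :=
  rowSheaf_mono (fun _ hD' => hD'.2.1) h

/-- the RULE-D conjunct of v41's lci rung. -/
theorem rowLci_ruleD_of_rung2b {σ : DepthBoundA4.Design → ℤ} {π : ℤ} (h : Rung2b C σ π) : RowLci LeggedFloor.RuleD C :=
  rowLci_mono (fun _ hD' => hD'.2.1) h

/-! ## ROW-α1's typed targets (pen theorems ∕ conjectural rows of memo-211; DEFINITIONS here, not theorems) -/

/-- **ROW-α1, SHEAF door, COKERNEL orientation** — memo-211 THEOREM α1 (PEN ×1): TRUE for every `C` and every window `I`, because a core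
passing the sheaf door has an `I`-semiregular cokernel with (A1) classes, hence (H2) `ob_κ(𝓔) = 0` on `T_W` (Buchweitz–Flenner), hence
by naturality of the Atiyah class + Künneth the span condition `RuleDSharp` of the shadow, hence `RuleD` (`RowAlpha1.ruleD_of_ruleDSharp`).
Not kernel-provable on the present interface. -/
def RowAlpha1Sheaf (C : ChernCharacterBetti) (I : Finset ℕ) : Prop := RowSheaf LeggedFloor.RuleD C I

/-- **ROW-α1, SHEAF door, KERNEL orientation** — RULE D of the SWAPPED shadow (memo-211 §6); the un-swapped reading of v41's `Rung2bSheafK`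
is NOT supported by the derivation. -/
def RowAlpha1SheafK (C : ChernCharacterBetti) (I : Finset ℕ) : Prop := RowSheafK LeggedFloor.RuleD C I

/-- **ROW-α1, lci door** — NOT derived (memo-211 §7); status C; line #2's 2b carries it as a law-row. -/
def RowAlpha1Lci (C : ChernCharacterBetti) : Prop := RowLci LeggedFloor.RuleD C

/-! ## The leg-free consequence (= s4 g39 `leg_free_ansatz_vacuous` at the row level; R19.853 (O5): the live room is the LEGGED one) -/

/-- under ROW-α1 (sheaf, cokernel), the shadow of a passing core that is LEG-FREE (`A4sharp`: every weakly-live arrow four-ample) has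
`μ = 0` — so together with the class row `μ ≠ 0` the LEG-FREE split-block SHEAF ansatz is EMPTY at every height, with no shell sieve
(`RuleDPlate.mu_eq_zero_of_a4sharp_ruleD`; memo-151 THEOREM (d)). -/
theorem rowSheaf_mu_eq_zero_of_legFree {I : Finset ℕ} (h : RowAlpha1Sheaf C I) :
    RowSheaf (fun D' => D'.A4sharp → D'.mu = 0) C I :=
  rowSheaf_mono (fun D' hD' hs => RuleDPlate.mu_eq_zero_of_a4sharp_ruleD D' hs hD') h

/-- the same sentence as a non-existence: no passing sheaf core has a leg-free shadow with `μ ≠ 0`. -/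
theorem no_legFree_sheafCore_of_rowAlpha1 {I : Finset ℕ} (h : RowAlpha1Sheaf C I)
    (E₀ : AbelianVariety ℂ) (ψ₀ : E₀ ⟶ E₀) (hE : E₀.dim = 1) (hψ : ψ₀ ≫ ψ₀ = -(1 • 𝟙 E₀))
    (δ : SplitBlockCore C E₀ ψ₀) (hδ : δ.PassesSheaf I) (hs : δ.Dsh.shadow.A4sharp) (hμ : δ.Dsh.shadow.mu ≠ 0) : False :=
  hμ (rowSheaf_mu_eq_zero_of_legFree h E₀ ψ₀ hE hψ δ hδ hs)

/-- kernel orientation, same consequence on the swapped shadow. -/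
theorem rowSheafK_mu_eq_zero_of_legFree {I : Finset ℕ} (h : RowAlpha1SheafK C I) :
    RowSheafK (fun D' => D'.A4sharp → D'.mu = 0) C I :=
  rowSheafK_mono (fun D' hD' hs => RuleDPlate.mu_eq_zero_of_a4sharp_ruleD D' hs hD') h

end Summit.HodgeConjecture.HodgeConjecture.Cruxes.BlochSeedDiscOne.SeedChecker.SplitBlock.RowAlpha1
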